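import Summits.Parity.GeneralizedHardyLittlewood.Theorems.LeeYangFibresCellParityLawInductionDefs
import Summits.Parity.GeneralizedHardyLittlewood.Theorems.LeeYangFibresCellParityLawKernelInductionAux
import Summits.Parity.GeneralizedHardyLittlewood.Theorems.LeeYangFibresCellParityLawKernelInductionStep
import HarnessLib

/-!
# Route `LeeYangFibres`, crux `CellParityLaw` (stmt-Parity-14109), line `section-annihilator`:
# the registered sub-goal `stub_inductionPackage` — packaging the cell laws into the strong kernel

Skeleton v19 (lead c6). This file proves `InductionPackage` (vocabulary file
`LeeYangFibresCellParityLawInductionDefs`):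

  `(∀ m ≥ 1, CellLawAt m) → EffectiveRoughCellLawStrong`.

`CellLawAt m` (`Q(m)`) is the `m`-cell law with the EXPLICIT parity parameter
`δ* = cellDelta 𝒜 x z = max 0 (2 − C₁/T)`, one cell index at a time, each with its own constants
`κ_m ∈ (0, 1]`, `C_m ≥ 0`, `η₀,m > 0`, `A₂,m`, `x₀,m` (depending on `m, u, A₁, L'`).
`EffectiveRoughCellLawStrong` asks for ONE set of constants and ONE `δ ∈ [0, 2]` serving every `m ≥ 1`.

Proof (E. Bombieri, RIMS Kôkyûroku 294 (1977) p. 5, bookkeeping only):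

* the witness is `δ := δ*`, which lies in `[0, 2]` because `C₁ ≥ 0` (a sub-sum of the size) and
  `T = e^γ V(z) A(x)/u' ≥ 0`;
* for `z ≥ x^{1/(u+1)}` only the cells `m ≤ u + 1` carry content: if `m ≥ u + 2` then
  `z^m ≥ x^{m/(u+1)} > x`, so `C_m(𝒜; x, z) = 0` (`VanishAux.roughCellSum_eq_zero_of_pow_le`), and
  `u' = log x/log z ≤ u + 1 < m` gives `I_m(u') = 0` (`roughCellDensity_of_lt`); the law reads `0 ≤ kernelErr`;
* the finitely many constants for `m = k + 1`, `k ∈ {0, …, u}`, merge by the monotonicity of the currency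
  (`KernelErrAux.kernelErr_mono`): `κ := min_k κ_k`, `C := Σ_k C_k`, `η₀ := min (min_k η₀,k) 1`,
  `A₂ := max_k A₂,k`, `x₀ := max (max_k x₀,k) (exp (2(u+1)))` (the last clause supplies `e ≤ z ≤ x`,
  `u' ≤ u + 1`).

References: E. Bombieri, RIMS Kôkyûroku 294 (1977) p. 5 [BombieriRIMS1977]; E. Bombieri, Rend. Accad. Naz. XL
(5) 1/2 (1975/76) [BombieriAsymptoticSieve1976].
-/

noncomputable section

open scoped BigOperators Classical
open Finset Literature.NumberTheory.Sieve

namespace Summit.Parity.GeneralizedHardyLittlewood.Cruxes.CellParityLaw.SectionAnnihilator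

namespace InductionPackageAux

/-- **Ranges of the data.** For `x ≥ exp (2(u+1))` and `x^{1/(u+1)} ≤ z ≤ x^{1/2}`:
`0 < x`, `e ≤ x`, `0 < z`, `e ≤ z`, `0 < log x`, `0 < log z`, `log x/(u+1) ≤ log z` and
`u' = log x/log z ≤ u + 1`. -/
theorem ranges {u : ℕ} {x z : ℝ} (hx : Real.exp (2 * ((u : ℝ) + 1)) ≤ x)
    (hzlo : x ^ (1 / ((u : ℝ) + 1)) ≤ z) (hzhi : z ≤ x ^ (1 / 2 : ℝ)) :
    0 < x ∧ Real.exp 1 ≤ x ∧ 0 < z ∧ Real.exp 1 ≤ z ∧ 0 < Real.log x ∧ 0 < Real.log z ∧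
      Real.log x / ((u : ℝ) + 1) ≤ Real.log z ∧ Real.log x / Real.log z ≤ (u : ℝ) + 1 := by
  have hu0 : (0 : ℝ) ≤ u := Nat.cast_nonneg u
  have hu10 : (0 : ℝ) < (u : ℝ) + 1 := by linarith
  have hx0 : 0 < x := (Real.exp_pos _).trans_le hx
  have hlxge : 2 * ((u : ℝ) + 1) ≤ Real.log x := by
    rw [← Real.log_exp (2 * ((u : ℝ) + 1))]
    exact Real.log_le_log (Real.exp_pos _) hx
  have hlx2 : 2 ≤ Real.log x := by nlinarith
  have hlx0 : 0 < Real.log x := by linarith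
  have hz0 : 0 < z := (Real.rpow_pos_of_pos hx0 _).trans_le hzlo
  have hlzlo : Real.log x / ((u : ℝ) + 1) ≤ Real.log z := by
    have h := Real.log_le_log (Real.rpow_pos_of_pos hx0 _) hzlo
    rw [Real.log_rpow hx0] at h
    calc Real.log x / ((u : ℝ) + 1) = 1 / ((u : ℝ) + 1) * Real.log x := by ring
      _ ≤ Real.log z := h
  have hlzhi : Real.log z ≤ Real.log x / 2 := by
    have h := Real.log_le_log hz0 hzhi
    rw [Real.log_rpow hx0] at h
    linarith
  have hlz2 : 2 ≤ Real.log z := by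
    refine le_trans ?_ hlzlo
    rw [le_div_iff₀ hu10]
    linarith
  have hlz0 : 0 < Real.log z := by linarith
  have hex : Real.exp 1 ≤ x := by
    rw [← Real.le_log_iff_exp_le hx0]
    linarith
  have hez : Real.exp 1 ≤ z := by
    rw [← Real.le_log_iff_exp_le hz0]
    linarith
  have hu'le : Real.log x / Real.log z ≤ (u : ℝ) + 1 := by
    rw [div_le_iff₀ hlz0]
    have h := (div_le_iff₀ hu10).mp hlzlo
    linarith
  exact ⟨hx0, hex, hz0, hez, hlx0, hlz0, hlzlo, hu'le⟩

/-- **Empty cells.** For `x ≥ exp (2(u+1))`, `x^{1/(u+1)} ≤ z ≤ x^{1/2}` and `m ≥ u + 2`: the cell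
`C_m(𝒜; x, z)` vanishes (`z^m ≥ x^{m/(u+1)} > x`) and so does the model density `I_m(log x/log z)`
(`log x/log z ≤ u + 1 < m`). -/
theorem cell_and_density_eq_zero (𝒜 : SieveSequence) {u m : ℕ} {x z : ℝ}
    (hx : Real.exp (2 * ((u : ℝ) + 1)) ≤ x) (hzlo : x ^ (1 / ((u : ℝ) + 1)) ≤ z)
    (hzhi : z ≤ x ^ (1 / 2 : ℝ)) (hm : u + 2 ≤ m) :
    roughCellSum 𝒜 x z m = 0 ∧ roughCellDensity m (Real.log x / Real.log z) = 0 := by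
  obtain ⟨hx0, -, hz0, -, hlx0, hlz0, hlzlo, hu'le⟩ := ranges hx hzlo hzhi
  have hm' : (u : ℝ) + 2 ≤ m := by exact_mod_cast hm
  have hu10 : (0 : ℝ) < (u : ℝ) + 1 := by positivity
  refine ⟨VanishAux.roughCellSum_eq_zero_of_pow_le 𝒜 hz0 ?_, roughCellDensity_of_lt m (by linarith)⟩
  -- `log x < m log z`
  have h1 : Real.log x < (m : ℝ) * Real.log z := by
    have e : ((u : ℝ) + 2) * (Real.log x / ((u : ℝ) + 1)) = Real.log x + Real.log x / ((u : ℝ) + 1) := by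
      field_simp
      ring
    calc Real.log x < ((u : ℝ) + 2) * (Real.log x / ((u : ℝ) + 1)) := by
          rw [e]; linarith [div_pos hlx0 hu10]
      _ ≤ (m : ℝ) * Real.log z :=
          mul_le_mul hm' hlzlo (div_nonneg hlx0.le hu10.le) (by positivity)
  rw [← Real.log_pow] at h1
  exact (Real.log_lt_log_iff hx0 (pow_pos hz0 m)).mp h1

end InductionPackageAux

open InductionPackageAux in
/-- **`stub_inductionPackage`** (registered sub-goal of `stub_kernelInduction`, skeleton v19, line
`section-annihilator`): the cell laws `Q(m) = CellLawAt m` for all `m ≥ 1` give `EffectiveRoughCellLawStrong`.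
The witness is `δ := δ* = cellDelta 𝒜 x z ∈ [0, 2]`; for `z ≥ x^{1/(u+1)}` the cells and the model densities
with `m ≥ u + 2` vanish (`InductionPackageAux.cell_and_density_eq_zero`), and the constants of the finitely many
laws `Q(k+1)`, `k ≤ u`, are merged by `KernelErrAux.kernelErr_mono`
(`κ := min`, `C := Σ`, `η₀ := min · 1`, `A₂ := max`, `x₀ := max · (exp (2(u+1)))`). -/
theorem stub_inductionPackage : InductionPackage := by
  intro h u A₁ L' hu
  -- the cell laws `Q(k+1)`, `k ∈ ℕ`, at `(u, A₁, L')`, with their constants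
  have hk : ∀ k : ℕ, ∃ (κ C η₀ : ℝ) (A₂ : ℕ) (x₀ : ℝ), 0 < κ ∧ κ ≤ 1 ∧ 0 ≤ C ∧ 0 < η₀ ∧
      ∀ (𝒜 : SieveSequence) (x z η Λ w₀ R : ℝ), x₀ ≤ x →
        x ^ (1 / ((u : ℝ) + 1)) ≤ z → z ≤ x ^ (1 / 2 : ℝ) →
        KernelRanges x η Λ w₀ η₀ → KernelAdmissible A₁ L' 𝒜 x η Λ w₀ R →
          |roughCellSum 𝒜 x z (k + 1) -
              (1 + (cellDelta 𝒜 x z - 1) * (-1 : ℝ) ^ (k + 1)) *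
                roughCellDensity (k + 1) (Real.log x / Real.log z) * primeMain 𝒜 x z|
            ≤ kernelErr C κ A₂ 𝒜 x z η Λ R :=
    fun k => h (k + 1) k.succ_pos u A₁ L' hu
  choose κ C η₀ A₂ x₀ hκ _hκ1 hC hη₀ hlaw using hk
  -- merged constants over the finitely many content-carrying cells `m = k + 1`, `k ∈ S = {0, …, u}`
  set S : Finset ℕ := Finset.range (u + 1) with hS
  have hSne : S.Nonempty := ⟨0, Finset.mem_range.mpr (Nat.succ_pos u)⟩
  set κs : ℝ := S.inf' hSne κ with hκs
  set Cs : ℝ := ∑ k ∈ S, C k with hCs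
  set η₀s : ℝ := min (S.inf' hSne η₀) 1 with hη₀s
  set A₂s : ℕ := S.sup A₂ with hA₂s
  set x₀s : ℝ := max (S.sup' hSne x₀) (Real.exp (2 * ((u : ℝ) + 1))) with hx₀s
  have hκs0 : 0 < κs := (Finset.lt_inf'_iff hSne).mpr fun k _ => hκ k
  have hκsle : ∀ k ∈ S, κs ≤ κ k := fun k hk => Finset.inf'_le _ hk
  have hCs0 : 0 ≤ Cs := Finset.sum_nonneg fun k _ => hC k
  have hCle : ∀ k ∈ S, C k ≤ Cs := fun k hk => Finset.single_le_sum (fun i _ => hC i) hk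
  have hη₀s0 : 0 < η₀s := lt_min ((Finset.lt_inf'_iff hSne).mpr fun k _ => hη₀ k) one_pos
  have hη₀sle : ∀ k ∈ S, η₀s ≤ η₀ k := fun k hk => (min_le_left _ _).trans (Finset.inf'_le _ hk)
  have hη₀s1 : η₀s ≤ 1 := min_le_right _ _
  have hA₂le : ∀ k ∈ S, A₂ k ≤ A₂s := fun k hk => Finset.le_sup hk
  have hx₀le : ∀ k ∈ S, x₀ k ≤ x₀s := fun k hk => (Finset.le_sup' _ hk).trans (le_max_left _ _)
  have hx₀e : Real.exp (2 * ((u : ℝ) + 1)) ≤ x₀s := le_max_right _ _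
  refine ⟨κs, Cs, η₀s, A₂s, x₀s, hκs0, hCs0, hη₀s0, ?_⟩
  intro 𝒜 x z η Λ w₀ R hx₀ hzlo hzhi hKR hKA
  obtain ⟨hηlo, hηhi, hΛ1, hΛhi, hw₀2, hw₀hi⟩ := hKR
  obtain ⟨-, -, -, hsize, -, hdim, -, hTypeI⟩ := id hKA
  rw [StrongTypeI] at hTypeI
  /- ranges of the data -/
  have hxe : Real.exp (2 * ((u : ℝ) + 1)) ≤ x := hx₀e.trans hx₀
  obtain ⟨-, hex, -, hez, hlx0, hlz0, -, -⟩ := ranges hxe hzlo hzhi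
  have he1 : 1 < Real.exp 1 := Real.one_lt_exp_iff.mpr one_pos
  have hx1 : 1 < x := he1.trans_le hex
  have hz1 : 1 < z := he1.trans_le hez
  have hη0 : 0 < η := (Real.rpow_pos_of_pos hlx0 _).trans_le hηlo
  have hη1 : η ≤ 1 := hηhi.trans hη₀s1
  have hΛh : 1 / 2 ≤ Λ := by linarith
  have hu'0 : 0 < Real.log x / Real.log z := div_pos hlx0 hlz0
  -- `R ≥ 0`, `C₁ ≥ 0`, `A ≥ 0`, `V > 0`, `T ≥ 0`
  have hR0 : 0 ≤ R := by
    have hT := hTypeI (fun _ => x) fun _ => le_rfl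
    exact le_trans (Finset.sum_nonneg fun _ _ => abs_nonneg _) hT
  have hC₁ := StepAux.roughCellSum_le_size 𝒜 x z 1 hsize
  have hA0 : 0 ≤ 𝒜.size x := hC₁.1.trans hC₁.2
  have hV0 : 0 < 𝒜.densityProduct (primesProdBelow z) := hdim.densityProduct_pos z
  have hT0 : 0 ≤ primeMain 𝒜 x z := by
    unfold primeMain
    exact div_nonneg (mul_nonneg (mul_nonneg (Real.exp_pos _).le hV0.le) hA0) hu'0.le
  /- the witness `δ := δ* ∈ [0, 2]` -/
  have hδ : 0 ≤ cellDelta 𝒜 x z ∧ cellDelta 𝒜 x z ≤ 2 := by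
    unfold cellDelta
    exact ⟨le_max_left _ _, max_le (by norm_num) (by linarith [div_nonneg hC₁.1 hT0])⟩
  refine ⟨cellDelta 𝒜 x z, hδ.1, hδ.2, fun m hm => ?_⟩
  rcases le_or_gt m (u + 1) with hmu | hmu
  · -- content-carrying cells `m = k + 1 ≤ u + 1`: `Q(k+1)` and the monotonicity of the currency
    obtain ⟨k, rfl⟩ : ∃ k, m = k + 1 := ⟨m - 1, by omega⟩
    have hkS : k ∈ S := Finset.mem_range.mpr (by omega)
    have hKRk : KernelRanges x η Λ w₀ (η₀ k) :=
      ⟨hηlo, hηhi.trans (hη₀sle k hkS), hΛ1, hΛhi, hw₀2, hw₀hi⟩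
    exact (hlaw k 𝒜 x z η Λ w₀ R ((hx₀le k hkS).trans hx₀) hzlo hzhi hKRk hKA).trans
      (KernelErrAux.kernelErr_mono (hC k) (hCle k hkS) hκs0 (hκsle k hkS) (hA₂le k hkS)
        hη0.le hη1 hΛh hez hex hV0.le hA0 hR0)
  · -- empty cells `m ≥ u + 2`: both the cell and the model vanish
    have hm2 : u + 2 ≤ m := by omega
    obtain ⟨hcell, hdens⟩ := cell_and_density_eq_zero 𝒜 hxe hzlo hzhi hm2
    have h0 : roughCellSum 𝒜 x z m -
        (1 + (cellDelta 𝒜 x z - 1) * (-1 : ℝ) ^ m) * roughCellDensity m (Real.log x / Real.log z) *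
          primeMain 𝒜 x z = 0 := by
      rw [hcell, hdens]; ring
    rw [h0, abs_zero]
    exact KernelErrAux.kernelErr_nonneg hCs0 hη0.le hΛh hz1 hx1.le hV0.le hA0 hR0

end Summit.Parity.GeneralizedHardyLittlewood.Cruxes.CellParityLaw.SectionAnnihilator

end
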